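import Mathlib

/-!
# Discrete Duhamel (variation-of-constants) inequality (solo-blind kernel #178)

Paper `steady-zeroth-law.md` §24.105 / PLAN §105 (E1-lite).  The kernel-box engine certifies floating-point trajectories of
the deleted chain by transporting their interval DEFECTS through LEMMA C's metric: on each grid sub-interval the error obeys
`e (n+1) ≤ a n * e n + b n` with a contraction factor `a n = exp(-(q n) Δ) ≥ 0` (certified rate, possibly `> 1` on short
transients) and a defect increment `b n`.  This file is the bookkeeping that turns the one-step inequality into the explicit
windowed bound, and its uniform corollaries.

* `discreteDuhamel_le` — `e n ≤ (∏_{j<n} a j) e 0 + ∑_{k<n} (∏_{j ∈ [k+1, n)} a j) b k`;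
* `discreteDuhamel_le_of_le` — with `a j ≤ α`, `0 ≤ e 0`, `0 ≤ b`: `e n ≤ α^n e 0 + ∑_{k<n} α^(n-1-k) b k`;
* `discreteDuhamel_le_geom` — with moreover `α < 1` and `b k ≤ β`: `e n ≤ α^n e 0 + β / (1 - α)`.
-/

namespace Summit.AnomalousDissipation.AnomalousDissipation.Theorems

open Finset

/-- Discrete Duhamel inequality: a one-step bound `e (n+1) ≤ a n * e n + b n` with `a n ≥ 0` unrolls to the
variation-of-constants sum. -/
theorem discreteDuhamel_le (a b e : ℕ → ℝ) (ha : ∀ n, 0 ≤ a n) (he : ∀ n, e (n + 1) ≤ a n * e n + b n) (n : ℕ) :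
    e n ≤ (∏ j ∈ range n, a j) * e 0 + ∑ k ∈ range n, (∏ j ∈ Ico (k + 1) n, a j) * b k := by
  induction n with
  | zero => simp
  | succ n ih =>
    have step : e (n + 1) ≤ a n * ((∏ j ∈ range n, a j) * e 0 + ∑ k ∈ range n, (∏ j ∈ Ico (k + 1) n, a j) * b k)
        + b n := (he n).trans (by gcongr; exact ha n)
    refine step.trans (le_of_eq ?_)
    have hk : ∀ k ∈ range n, (∏ j ∈ Ico (k + 1) (n + 1), a j) * b k = a n * ((∏ j ∈ Ico (k + 1) n, a j) * b k) := by
      intro k hk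
      have hkn : k + 1 ≤ n := Nat.succ_le_of_lt (mem_range.mp hk)
      rw [Finset.prod_Ico_succ_top hkn]; ring
    rw [prod_range_succ, sum_range_succ, Finset.Ico_self, prod_empty, one_mul, sum_congr rfl hk, ← mul_sum]
    ring

/-- Uniform version: if every contraction factor is `≤ α` (and `e 0`, `b` are nonnegative) then
`e n ≤ α ^ n * e 0 + ∑_{k<n} α ^ (n - 1 - k) * b k`. -/
theorem discreteDuhamel_le_of_le (a b e : ℕ → ℝ) {α : ℝ} (ha : ∀ n, 0 ≤ a n) (haα : ∀ n, a n ≤ α)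
    (he : ∀ n, e (n + 1) ≤ a n * e n + b n) (he0 : 0 ≤ e 0) (hb : ∀ n, 0 ≤ b n) (n : ℕ) :
    e n ≤ α ^ n * e 0 + ∑ k ∈ range n, α ^ (n - 1 - k) * b k := by
  have hprod : ∀ s : Finset ℕ, ∏ j ∈ s, a j ≤ α ^ s.card := fun s => by
    calc ∏ j ∈ s, a j ≤ ∏ _j ∈ s, α := prod_le_prod (fun j _ => ha j) fun j _ => haα j
      _ = α ^ s.card := by simp
  refine (discreteDuhamel_le a b e ha he n).trans ?_
  gcongr with k hk
  · simpa using hprod (range n)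
  · exact hb k
  · have := hprod (Ico (k + 1) n)
    simpa [Nat.card_Ico, show n - (k + 1) = n - 1 - k by omega] using this

/-- Geometric version: with `0 ≤ a n ≤ α < 1`, `0 ≤ b n ≤ β` and `0 ≤ e 0`, the error never exceeds
`α ^ n * e 0 + β / (1 - α)`. -/
theorem discreteDuhamel_le_geom (a b e : ℕ → ℝ) {α β : ℝ} (ha : ∀ n, 0 ≤ a n) (haα : ∀ n, a n ≤ α) (hα1 : α < 1)
    (he : ∀ n, e (n + 1) ≤ a n * e n + b n) (he0 : 0 ≤ e 0) (hb : ∀ n, 0 ≤ b n) (hbβ : ∀ n, b n ≤ β) (n : ℕ) :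
    e n ≤ α ^ n * e 0 + β / (1 - α) := by
  have hα0 : 0 ≤ α := (ha 0).trans (haα 0)
  refine (discreteDuhamel_le_of_le a b e ha haα he he0 hb n).trans ?_
  gcongr
  calc ∑ k ∈ range n, α ^ (n - 1 - k) * b k ≤ ∑ k ∈ range n, α ^ (n - 1 - k) * β := by
        gcongr with k hk
        exact hbβ k
    _ = (∑ k ∈ range n, α ^ k) * β := by
        rw [sum_mul]
        exact sum_range_reflect (fun k => α ^ k * β) n
    _ ≤ 1 / (1 - α) * β := by
        have hβ : 0 ≤ β := (hb 0).trans (hbβ 0)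
        have h : ∑ i ∈ Ico 0 n, α ^ i ≤ α ^ 0 / (1 - α) := geom_sum_Ico_le_of_lt_one hα0 hα1
        have h' : ∑ k ∈ range n, α ^ k ≤ 1 / (1 - α) := by simpa using h
        exact mul_le_mul_of_nonneg_right h' hβ
    _ = β / (1 - α) := by ring

end Summit.AnomalousDissipation.AnomalousDissipation.Theorems
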